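import Literature.Barriers.CriticalPhenomena.SAPAnisotropicNotDFinite242Words
import HarnessLib

/-!
# The shape of a canonical 2-4-2 word: bottom row, band, duplicated row, orientation

Proofs companion (second part) of
`Literature/Barriers/CriticalPhenomena/SAPAnisotropicNotDFinite242Hadamard.lean` (A. Rechnitzer,
*Haruspicy 2*, J. Combin. Theory Ser. A 113 (2006) 520–546, arXiv:math/0406450v2, §3.3), towards
the discharge of `Rechnitzer2006_lem23` (Lemma 23, the seed / building-block decomposition).
After `SAPAnisotropicNotDFinite242Words` (`p^{242}_k(m,w) = #c242Words k m w`,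
`bb(M,t,w) = #bbWords M t w`: 2-4-2 polygons and building blocks are canonical SAP words —
rooted at the lowest-leftmost vertex, first letter `E`), this file establishes the SHAPE of such
a word `W` (vertices `vtx W i = (x i, y i)`), which is what the cut-and-glue bijection of
Lemma 23 manipulates:

* `excursion_of_two_crossings` — an integer sequence with steps `0, ±1` crossing the cell row
  `r` exactly twice makes a single excursion above `r` (the discrete intermediate value
  principle behind "every second row of a 2-4-2 polygon contains `2` vertical bonds");
* `IsSAP.run`, `cover` — horizontal stretches of a self-avoiding word are straight; a stretch
  visits every column between its ends;
* `IsCanon.bottom_row` — a canonical word whose bottom cell row has two vertical bonds is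
  `E^w N γ S`, `w = bottomWidth ≥ 1`, `γ` at heights `≥ 1` from `(w, 1)` to `(0, 1)`;
* `IsCanon.exists_isBand` (`IsBand W w p q`) — if the three lowest cell rows carry `2, ≤ 4, 2`
  vertical bonds, then `W = E^w N α₁ N β S α₂ S`: `α₁, α₂` in the band of heights `{1, 2}`,
  the up-step of the third row at time `p` in column `b`, the excursion `β` at heights `≥ 3`,
  the down-step at time `q` in column `a`, and — the ORIENTATION LEMMA `IsSAP.lt_of_band` —
  `a < b`: one of `α₁, α₂` has a single vertical bond (parity, `card_changes_mod_two`), hence is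
  two straight runs forming a wall in one column, which the other cannot pass (`cover`); so the
  polygon above the duplicated row, read in the induced orientation, is again canonical;
* `IsBand.top_run` — for a building block (all heights `≤ 3`) the excursion is the straight
  run `W^t` at height `3`, `t = b - a`, the top row.

[folklore] throughout (elementary combinatorics of lattice walks); the decomposition is that of
[Rechnitzer2006Haruspicy2], Lemma 23 and Figures 9–10.
-/

noncomputable section

open Finset Literature.Probability.LatticeModels Literature.Probability.Percolation
open scoped BigOperators

namespace Literature.Barriers.CriticalPhenomena

namespace Haruspicy

open Edwards2D

/-! ### Coordinates along a word -/

section Coordinates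

variable {W : List (Fin 4)}

/-- The four kinds of letters, in coordinates. [folklore] -/
theorem step_cases (W : List (Fin 4)) {k : ℕ} (hk : k < W.length) :
    (W[k] = 0 ∧ vtx W (k + 1) 0 = vtx W k 0 + 1 ∧ vtx W (k + 1) 1 = vtx W k 1) ∨
    (W[k] = 1 ∧ vtx W (k + 1) 0 = vtx W k 0 - 1 ∧ vtx W (k + 1) 1 = vtx W k 1) ∨
    (W[k] = 2 ∧ vtx W (k + 1) 0 = vtx W k 0 ∧ vtx W (k + 1) 1 = vtx W k 1 + 1) ∨
    (W[k] = 3 ∧ vtx W (k + 1) 0 = vtx W k 0 ∧ vtx W (k + 1) 1 = vtx W k 1 - 1) := by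
  have h := vtx_succ W hk
  generalize W[k] = a at h ⊢
  fin_cases a
  · left; simp [h]
  · right; left; simp [h, sub_eq_add_neg]
  · right; right; left; simp [h]
  · right; right; right; simp [h, sub_eq_add_neg]

/-- One step changes the abscissa by at most one … [folklore] -/
theorem abs_sub_le_zero (W : List (Fin 4)) {k : ℕ} (hk : k < W.length) :
    vtx W (k + 1) 0 - vtx W k 0 ≤ 1 ∧ vtx W k 0 - vtx W (k + 1) 0 ≤ 1 := by
  rcases step_cases W hk with ⟨-, h0, -⟩ | ⟨-, h0, -⟩ | ⟨-, h0, -⟩ | ⟨-, h0, -⟩ <;> omega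

/-- … and the ordinate by `0` or `±1`. [folklore] -/
theorem dy_cases (W : List (Fin 4)) {k : ℕ} (hk : k < W.length) :
    vtx W (k + 1) 1 = vtx W k 1 ∨ vtx W (k + 1) 1 = vtx W k 1 + 1 ∨
      vtx W (k + 1) 1 = vtx W k 1 - 1 := by
  rcases step_cases W hk with ⟨-, -, h1⟩ | ⟨-, -, h1⟩ | ⟨-, -, h1⟩ | ⟨-, -, h1⟩ <;> omega

/-- A letter is horizontal iff it keeps the ordinate. [folklore] -/
theorem val_lt_two_iff (W : List (Fin 4)) {k : ℕ} (hk : k < W.length) :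
    (W[k]).val < 2 ↔ vtx W (k + 1) 1 = vtx W k 1 := by
  rcases step_cases W hk with ⟨h, -, h1⟩ | ⟨h, -, h1⟩ | ⟨h, -, h1⟩ | ⟨h, -, h1⟩ <;>
    simp only [h] <;> omega

/-- A step to the east is the letter `E`. [folklore] -/
theorem eq_zero_of_dx (W : List (Fin 4)) {k : ℕ} (hk : k < W.length)
    (h : vtx W (k + 1) 0 = vtx W k 0 + 1) : W[k] = 0 := by
  rcases step_cases W hk with ⟨h', -, -⟩ | ⟨-, h0, -⟩ | ⟨-, h0, -⟩ | ⟨-, h0, -⟩ <;> omega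

/-- A step to the west is the letter `W`. [folklore] -/
theorem eq_one_of_dx (W : List (Fin 4)) {k : ℕ} (hk : k < W.length)
    (h : vtx W (k + 1) 0 = vtx W k 0 - 1) : W[k] = 1 := by
  rcases step_cases W hk with ⟨-, h0, -⟩ | ⟨h', -, -⟩ | ⟨-, h0, -⟩ | ⟨-, h0, -⟩ <;> omega

/-- A step to the north is the letter `N`. [folklore] -/
theorem eq_two_of_dy (W : List (Fin 4)) {k : ℕ} (hk : k < W.length)
    (h : vtx W (k + 1) 1 = vtx W k 1 + 1) : W[k] = 2 := by
  rcases step_cases W hk with ⟨-, -, h1⟩ | ⟨-, -, h1⟩ | ⟨h', -, -⟩ | ⟨-, -, h1⟩ <;> omega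

/-- A step to the south is the letter `S`. [folklore] -/
theorem eq_three_of_dy (W : List (Fin 4)) {k : ℕ} (hk : k < W.length)
    (h : vtx W (k + 1) 1 = vtx W k 1 - 1) : W[k] = 3 := by
  rcases step_cases W hk with ⟨-, -, h1⟩ | ⟨-, -, h1⟩ | ⟨-, -, h1⟩ | ⟨h', -, -⟩ <;> omega

/-- A vertical step keeps the abscissa. [folklore] -/
theorem dx_eq_zero_of_dy_ne (W : List (Fin 4)) {k : ℕ} (hk : k < W.length)
    (h : vtx W (k + 1) 1 ≠ vtx W k 1) : vtx W (k + 1) 0 = vtx W k 0 := by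
  rcases step_cases W hk with ⟨-, -, h1⟩ | ⟨-, -, h1⟩ | ⟨-, h0, -⟩ | ⟨-, h0, -⟩ <;> omega

end Coordinates

/-! ### Filtered cardinalities with arbitrary decidability instances -/

/-- `#(s.filter p)` only depends on `p` on `s` (any instances). [folklore] -/
theorem card_filter_congr' {α : Type*} {s : Finset α} {p q : α → Prop} {_ : DecidablePred p}
    {_ : DecidablePred q} (h : ∀ x ∈ s, p x ↔ q x) : (s.filter p).card = (s.filter q).card := by
  congr 1
  ext x
  simp only [Finset.mem_filter, and_congr_right_iff]
  exact h x

/-- A filter of `range n` determined to be `range m`. [folklore] -/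
theorem card_filter_range_eq {p : ℕ → Prop} {_ : DecidablePred p} {n m : ℕ} (hmn : m ≤ n)
    (h : ∀ i < n, p i ↔ i < m) : ((Finset.range n).filter p).card = m := by
  have : (Finset.range n).filter p = Finset.range m := by
    ext i
    simp only [Finset.mem_filter, Finset.mem_range]
    constructor
    · rintro ⟨hi, hp⟩; exact (h i hi).1 hp
    · intro hi; exact ⟨by omega, (h i (by omega)).2 hi⟩
  rw [this, Finset.card_range]

/-- A filter of `range n` determined to be an interval `[a, b)`. [folklore] -/
theorem card_filter_range_eq_Ico {p : ℕ → Prop} {_ : DecidablePred p} {n a b : ℕ}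
    (hbn : b ≤ n) (h : ∀ i < n, p i ↔ a ≤ i ∧ i < b) :
    ((Finset.range n).filter p).card = b - a := by
  have : (Finset.range n).filter p = Finset.Ico a b := by
    ext i
    simp only [Finset.mem_filter, Finset.mem_range, Finset.mem_Ico]
    constructor
    · rintro ⟨hi, hp⟩; exact (h i hi).1 hp
    · intro hi; exact ⟨by omega, (h i (by omega)).2 hi⟩
  rw [this, Nat.card_Ico]

/-! ### Crossings of a row: the excursion lemma -/

/-- The step `a → b` of ordinates crosses the cell row `r` (is a vertical bond `{r, r+1}`). [folklore] -/
def IsCross (r a b : ℤ) : Prop := (a = r ∧ b = r + 1) ∨ (a = r + 1 ∧ b = r)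

/-- `IsCross` is decidable. [folklore] -/
instance (r a b : ℤ) : Decidable (IsCross r a b) := by
  unfold IsCross; infer_instance

/-- **The excursion lemma.** An integer sequence with steps in `{0, ±1}`, starting at height
`≤ r` and crossing the row `r` exactly twice (at the indices in `S`, `#S = 2`), makes a single
excursion above `r`: it goes up at `p`, stays `≥ r + 1` on `(p, q]`, comes down at `q`, and is
`≤ r` before `p` and after `q`. [folklore] -/
theorem excursion_of_two_crossings (f : ℕ → ℤ) (n : ℕ) (r : ℤ)
    (hstep : ∀ i < n, f (i + 1) = f i ∨ f (i + 1) = f i + 1 ∨ f (i + 1) = f i - 1)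
    (h0 : f 0 ≤ r) (S : Finset ℕ) (hS : ∀ i, i ∈ S ↔ i < n ∧ IsCross r (f i) (f (i + 1)))
    (h2 : S.card = 2) :
    ∃ p q, p < q ∧ q < n ∧ f p = r ∧ f (p + 1) = r + 1 ∧ f q = r + 1 ∧ f (q + 1) = r ∧
      (∀ i ≤ p, f i ≤ r) ∧ (∀ i, p < i → i ≤ q → r + 1 ≤ f i) ∧
        (∀ i, q < i → i ≤ n → f i ≤ r) := by
  obtain ⟨p, q, hpq, hSpq⟩ := Finset.card_eq_two.1 h2
  wlog hlt : p < q generalizing p q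
  · exact this q p hpq.symm (by rw [hSpq, Finset.pair_comm]) (by omega)
  have hp : p < n ∧ IsCross r (f p) (f (p + 1)) := (hS p).1 (by rw [hSpq]; simp)
  have hq : q < n ∧ IsCross r (f q) (f (q + 1)) := (hS q).1 (by rw [hSpq]; simp)
  have hno : ∀ i < n, i ≠ p → i ≠ q → ¬ IsCross r (f i) (f (i + 1)) := by
    intro i hi h1 h2 hc
    have : i ∈ S := (hS i).2 ⟨hi, hc⟩
    rw [hSpq, Finset.mem_insert, Finset.mem_singleton] at this
    omega
  have hA : ∀ i ≤ p, f i ≤ r := by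
    intro i hi
    induction i with
    | zero => exact h0
    | succ i ih =>
      have ih' := ih (by omega)
      have hni := hno i (by omega) (by omega) (by omega)
      unfold IsCross at hni
      rcases hstep i (by omega) with h | h | h <;> omega
  have hfp : f p = r ∧ f (p + 1) = r + 1 := by
    have := hA p le_rfl
    unfold IsCross at hp
    omega
  have hB : ∀ i, p < i → i ≤ q → r + 1 ≤ f i := by
    intro i hpi hiq
    induction i with
    | zero => omega
    | succ i ih =>
      rcases Nat.lt_or_ge p i with hpi' | hpi'
      · have ih' := ih hpi' (by omega)
        have hni := hno i (by omega) (by omega) (by omega)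
        unfold IsCross at hni
        rcases hstep i (by omega) with h | h | h <;> omega
      · obtain rfl : i = p := by omega
        omega
  have hfq : f q = r + 1 ∧ f (q + 1) = r := by
    have := hB q hlt le_rfl
    unfold IsCross at hq
    omega
  have hC : ∀ i, q < i → i ≤ n → f i ≤ r := by
    intro i hqi hin
    induction i with
    | zero => omega
    | succ i ih =>
      rcases Nat.lt_or_ge q i with hqi' | hqi'
      · have ih' := ih hqi' (by omega)
        have hni := hno i (by omega) (by omega) (by omega)
        unfold IsCross at hni
        rcases hstep i (by omega) with h | h | h <;> omega
      · obtain rfl : i = q := by omega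
        omega
  exact ⟨p, q, hlt, hq.1, hfp.1, hfp.2, hfq.1, hfq.2, hA, hB, hC⟩

/-! ### The bond statistics of a word through its vertices -/

section BondStats

variable {W : List (Fin 4)}

open Classical in
/-- The vertical bonds of `bonds W` in row `r` are the crossings of row `r` by the ordinate.
[folklore] -/
theorem rowVerticalBonds_bonds (W : List (Fin 4)) (r : ℤ) :
    rowVerticalBonds (bonds W) r =
      ((Finset.range W.length).filter fun i => IsCross r (vtx W i 1) (vtx W (i + 1) 1)).card := by
  rw [rowVerticalBonds, bonds, countP_map_range]
  refine card_filter_congr' fun i hi => ?_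
  rw [Finset.mem_range] at hi
  simp only [decide_eq_true_eq, IsCross]
  rcases step_cases W hi with ⟨-, h0, h1⟩ | ⟨-, h0, h1⟩ | ⟨-, h0, h1⟩ | ⟨-, h0, h1⟩ <;> omega

open Classical in
/-- The bottom row of `bonds W`: the steps along the line `y = yMin`. [folklore] -/
theorem bottomWidth_bonds (W : List (Fin 4)) :
    bottomWidth (bonds W) = ((Finset.range W.length).filter fun i =>
      vtx W i 1 = yMin (bonds W) ∧ vtx W (i + 1) 1 = yMin (bonds W)).card := by
  rw [bottomWidth, bonds, countP_map_range]
  refine card_filter_congr' fun i _ => ?_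
  simp only [decide_eq_true_eq]

open Classical in
/-- The top row of `bonds W`: the steps along the line `y = yMax`. [folklore] -/
theorem topWidth_bonds (W : List (Fin 4)) :
    topWidth (bonds W) = ((Finset.range W.length).filter fun i =>
      vtx W i 1 = yMax (bonds W) ∧ vtx W (i + 1) 1 = yMax (bonds W)).card := by
  rw [topWidth, bonds, countP_map_range]
  refine card_filter_congr' fun i _ => ?_
  simp only [decide_eq_true_eq]

open Classical in
/-- The horizontal letters of `W` are the steps keeping the ordinate. [folklore] -/
theorem hcount_eq_card_filter (W : List (Fin 4)) :
    hcount W = ((Finset.range W.length).filter fun i => vtx W (i + 1) 1 = vtx W i 1).card := by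
  have key : ∀ n ≤ W.length, hcount (W.take n) =
      ((Finset.range n).filter fun i => vtx W (i + 1) 1 = vtx W i 1).card := by
    intro n hn
    induction n with
    | zero => simp [hcount]
    | succ n ih =>
      unfold hcount at ih ⊢
      rw [countP_take_succ _ _ (by omega), ih (by omega), Finset.range_add_one, Finset.filter_insert]
      simp only [decide_eq_true_eq]
      have hiff := val_lt_two_iff W (show n < W.length by omega)
      by_cases h : vtx W (n + 1) 1 = vtx W n 1
      · rw [if_pos (hiff.2 h), if_pos h, Finset.card_insert_of_notMem (by simp)]
      · rw [if_neg (fun h' => h (hiff.1 h')), if_neg h, Nat.add_zero]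
  have := key W.length le_rfl
  rwa [List.take_length] at this

/-- `yMin (bonds W)` is at most every ordinate of a source. [folklore] -/
theorem yMin_bonds_le (W : List (Fin 4)) {i : ℕ} (hi : i < W.length) :
    yMin (bonds W) ≤ vtx W i 1 :=
  foldr_min_le_of_mem (mem_map_fst_bonds (fun p => p 1) hi)

/-- `yMin (bonds W) ≤ 0`. [folklore] -/
theorem yMin_bonds_le_zero (W : List (Fin 4)) : yMin (bonds W) ≤ 0 := foldr_min_le_init _ _

/-- `yMin (bonds W)` is `0` or attained. [folklore] -/
theorem yMin_bonds_cases (W : List (Fin 4)) :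
    yMin (bonds W) = 0 ∨ ∃ i < W.length, vtx W i 1 = yMin (bonds W) := by
  rcases foldr_min_mem 0 ((bonds W).map fun b => b.1 1) with h | h
  · exact Or.inl h
  · obtain ⟨b, hb, hb'⟩ := List.mem_map.1 h
    obtain ⟨i, hi, rfl⟩ := mem_bonds.1 hb
    exact Or.inr ⟨i, hi, hb'⟩

/-- Every ordinate of a source is at most `yMax (bonds W)`. [folklore] -/
theorem le_yMax_bonds (W : List (Fin 4)) {i : ℕ} (hi : i < W.length) :
    vtx W i 1 ≤ yMax (bonds W) :=
  le_foldr_max_of_mem (mem_map_fst_bonds (fun p => p 1) hi)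

/-- `0 ≤ yMax (bonds W)`. [folklore] -/
theorem yMax_bonds_nonneg (W : List (Fin 4)) : 0 ≤ yMax (bonds W) := le_foldr_max_init _ _

/-- `yMax (bonds W)` is `0` or attained. [folklore] -/
theorem yMax_bonds_cases (W : List (Fin 4)) :
    yMax (bonds W) = 0 ∨ ∃ i < W.length, vtx W i 1 = yMax (bonds W) := by
  rcases foldr_max_mem 0 ((bonds W).map fun b => b.1 1) with h | h
  · exact Or.inl h
  · obtain ⟨b, hb, hb'⟩ := List.mem_map.1 h
    obtain ⟨i, hi, rfl⟩ := mem_bonds.1 hb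
    exact Or.inr ⟨i, hi, hb'⟩

/-- `yMax (bonds W)` is determined by an upper bound that is attained. [folklore] -/
theorem yMax_bonds_eq {M : ℤ} (hM0 : 0 ≤ M) (hle : ∀ i < W.length, vtx W i 1 ≤ M) {j : ℕ}
    (hj : j < W.length) (hM : vtx W j 1 = M) : yMax (bonds W) = M := by
  refine le_antisymm ?_ (hM ▸ le_yMax_bonds W hj)
  rcases yMax_bonds_cases W with h | ⟨i, hi, he⟩
  · rw [h]; exact hM0
  · rw [← he]; exact hle i hi

/-- In a rooted word every vertex has a non-negative ordinate … [folklore] -/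
theorem IsRooted.vtx_one_nonneg (h : IsRooted W) {i : ℕ} (hi : i < W.length) : 0 ≤ vtx W i 1 := by
  have := h i hi
  rw [key_le_key] at this
  simp only [Pi.zero_apply] at this
  omega

/-- … and the vertices on the axis have non-negative abscissa. [folklore] -/
theorem IsRooted.vtx_zero_nonneg (h : IsRooted W) {i : ℕ} (hi : i < W.length)
    (h0 : vtx W i 1 = 0) : 0 ≤ vtx W i 0 := by
  have := h i hi
  rw [key_le_key] at this
  simp only [Pi.zero_apply] at this
  omega

/-- For a rooted word `yMin (bonds W) = 0`. [folklore] -/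
theorem IsRooted.yMin_bonds (h : IsRooted W) : yMin (bonds W) = 0 := by
  rcases yMin_bonds_cases W with h0 | ⟨i, hi, he⟩
  · exact h0
  · exact le_antisymm (yMin_bonds_le_zero W) (he ▸ h.vtx_one_nonneg hi)

/-- In a closed rooted word all ordinates `vtx W i 1`, `i ≤ |W|`, are non-negative. [folklore] -/
theorem IsRooted.vtx_one_nonneg' (h : IsRooted W) (hc : (W.map stepVec).sum = 0) {i : ℕ}
    (hi : i ≤ W.length) : 0 ≤ vtx W i 1 := by
  rcases hi.lt_or_eq with hi | rfl
  · exact h.vtx_one_nonneg hi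
  · rw [vtx_length, hc]; rfl

end BondStats
/-! ### Straight runs, intermediate columns, parity of changes -/

section Runs

variable {W : List (Fin 4)}

/-- No immediate reversal: two consecutive horizontal letters of a SAP word coincide.
[folklore] -/
theorem IsSAP.getElem_eq_of_horizontal (h : IsSAP W) {i : ℕ} (hi : i + 1 < W.length)
    (h1 : (W[i]).val < 2) (h2 : (W[i + 1]).val < 2) : W[i] = W[i + 1] := by
  by_contra hne
  have hsum : stepVec W[i] + stepVec W[i + 1] = 0 := by
    generalize W[i] = a at h1 hne ⊢
    generalize W[i + 1] = b at h2 hne ⊢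
    fin_cases a <;> fin_cases b <;> simp_all
  have heq : vtx W (i + 2) = vtx W i := by
    rw [show i + 2 = i + 1 + 1 from rfl, vtx_succ W hi, vtx_succ W (by omega), add_assoc, hsum,
      add_zero]
  have key := h.mod_eq_mod (show i + 2 ≤ W.length by omega) (show i ≤ W.length by omega) heq
  rw [Nat.mod_eq_of_lt (show i < W.length by omega)] at key
  rcases Nat.lt_or_ge (i + 2) W.length with hlt | hge
  · rw [Nat.mod_eq_of_lt hlt] at key; omega
  · have hN : i + 2 = W.length := by omega
    rw [hN, Nat.mod_self] at key
    have := h.1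
    omega

/-- A horizontal step moves the abscissa by `±1`. [folklore] -/
theorem dx_of_horizontal (W : List (Fin 4)) {k : ℕ} (hk : k < W.length)
    (hh : vtx W (k + 1) 1 = vtx W k 1) :
    vtx W (k + 1) 0 - vtx W k 0 = 1 ∨ vtx W (k + 1) 0 - vtx W k 0 = -1 := by
  rcases step_cases W hk with ⟨-, h0, -⟩ | ⟨-, h0, -⟩ | ⟨-, -, h1⟩ | ⟨-, -, h1⟩ <;> omega

/-- **Runs are straight.** Along a stretch `[a, b]` of constant ordinate of a SAP word the
abscissa moves at the constant unit speed of the first step. [folklore] -/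
theorem IsSAP.run (h : IsSAP W) {a b : ℕ} (hb : b ≤ W.length)
    (hrun : ∀ j, a ≤ j → j < b → vtx W (j + 1) 1 = vtx W j 1) :
    ∀ j, a ≤ j → j ≤ b → vtx W j 1 = vtx W a 1 ∧
      vtx W j 0 = vtx W a 0 + ((j - a : ℕ) : ℤ) * (vtx W (a + 1) 0 - vtx W a 0) ∧
        (j < b → vtx W (j + 1) 0 - vtx W j 0 = vtx W (a + 1) 0 - vtx W a 0) := by
  intro j haj
  induction j, haj using Nat.le_induction with
  | base => intro _; simp
  | succ j haj ih =>
    intro hjb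
    obtain ⟨ih1, ih2, ih3⟩ := ih (by omega)
    have hd := ih3 (by omega)
    refine ⟨by rw [hrun j haj (by omega), ih1], ?_, fun hjb' => ?_⟩
    · rw [show ((j + 1 - a : ℕ) : ℤ) = ((j - a : ℕ) : ℤ) + 1 by
        push_cast [Nat.sub_add_comm haj]; ring]
      linear_combination ih2 + hd
    · rw [← hd]
      have h1 : (W[j]).val < 2 := (val_lt_two_iff W (by omega)).2 (hrun j haj (by omega))
      have h2 : (W[j + 1]).val < 2 :=
        (val_lt_two_iff W (by omega)).2 (hrun (j + 1) (by omega) hjb')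
      have heq := h.getElem_eq_of_horizontal (by omega) h1 h2
      have e1 : vtx W (j + 1) 0 - vtx W j 0 = stepVec W[j] 0 := by
        rw [vtx_succ W (show j < W.length by omega)]; simp
      have e2 : vtx W (j + 1 + 1) 0 - vtx W (j + 1) 0 = stepVec W[j + 1] 0 := by
        rw [vtx_succ W (show j + 1 < W.length by omega)]; simp
      rw [e1, e2, heq]

/-- **Intermediate columns.** A stretch `[a, b]` of a lattice word visits every column between
the columns of its ends. [folklore] -/
theorem cover (W : List (Fin 4)) {a b : ℕ} (hab : a ≤ b) (hb : b ≤ W.length) {z : ℤ}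
    (hz : min (vtx W a 0) (vtx W b 0) ≤ z ∧ z ≤ max (vtx W a 0) (vtx W b 0)) :
    ∃ j, a ≤ j ∧ j ≤ b ∧ vtx W j 0 = z := by
  induction b, hab using Nat.le_induction with
  | base => exact ⟨a, le_rfl, le_rfl, by omega⟩
  | succ b hab ih =>
    have hs := abs_sub_le_zero W (show b < W.length by omega)
    by_cases hz' : min (vtx W a 0) (vtx W b 0) ≤ z ∧ z ≤ max (vtx W a 0) (vtx W b 0)
    · obtain ⟨j, h1, h2, h3⟩ := ih (by omega) hz'
      exact ⟨j, h1, by omega, h3⟩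
    · exact ⟨b + 1, by omega, le_rfl, by omega⟩

/-- No change on `[a, b)` keeps a sequence constant on `[a, b]`. [folklore] -/
theorem constant_of_no_change (f : ℕ → ℤ) {a b : ℕ}
    (h : ∀ i, a ≤ i → i < b → f (i + 1) = f i) : ∀ j, a ≤ j → j ≤ b → f j = f a := by
  intro j haj hjb
  induction j, haj using Nat.le_induction with
  | base => rfl
  | succ j haj ih => rw [h j haj (by omega), ih (by omega)]

/-- **Parity of changes.** A two-valued sequence on `[a, b]` changes value an even number of
times iff it ends where it started. [folklore] -/
theorem card_changes_mod_two (f : ℕ → ℤ) (c : ℤ) {a b : ℕ} (hab : a ≤ b)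
    (hval : ∀ i, a ≤ i → i ≤ b → f i = c ∨ f i = c + 1) :
    ((Finset.Ico a b).filter fun i => f (i + 1) ≠ f i).card % 2 = if f b = f a then 0 else 1 := by
  induction b, hab using Nat.le_induction with
  | base => simp
  | succ b hab ih =>
    have ih' := ih fun i h1 h2 => hval i h1 (by omega)
    have hb1 := hval (b + 1) (by omega) le_rfl
    have hbv := hval b hab (by omega)
    have hav := hval a le_rfl (by omega)
    rw [Nat.Ico_succ_right_eq_insert_Ico hab, Finset.filter_insert]
    by_cases hch : f (b + 1) ≠ f b
    · rw [if_pos hch, Finset.card_insert_of_notMem (by simp), Nat.add_mod, ih']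
      split_ifs <;> omega
    · rw [if_neg hch, ih']
      push Not at hch
      split_ifs <;> omega

end Runs

/-! ### The bottom row of a canonical word -/

section Bottom

variable {W : List (Fin 4)}

/-- The first letter of a canonical word is `E`: `vtx W 1 = (1, 0)`. [folklore] -/
theorem IsCanon.vtx_one (h : IsCanon W) : vtx W 1 0 = 1 ∧ vtx W 1 1 = 0 := by
  have hN : 0 < W.length := h.1.length_pos
  have hW0 : W[0] = 0 := by
    have hh := h.2.2
    rw [List.head?_eq_getElem?, List.getElem?_eq_getElem hN] at hh
    exact Option.some.inj hh
  rcases step_cases W hN with ⟨-, h0, h1⟩ | ⟨h', -⟩ | ⟨h', -⟩ | ⟨h', -⟩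
  · simp only [vtx_zero, Pi.zero_apply, zero_add] at h0 h1; exact ⟨h0, h1⟩
  all_goals rw [hW0] at h'; exact absurd h' (by decide)

/-- **The bottom row of a canonical word whose bottom cell row carries two vertical bonds**
(e.g. a 2-4-2 polygon rooted at its lowest-leftmost vertex): the word is `E^w N γ S` with
`w = bottomWidth ≥ 1`, the vertices `(i, 0)`, `i ≤ w`, then `(w, 1)`, and `γ` runs at heights
`≥ 1` from `(w, 1)` to `(0, 1)`. [cite: Rechnitzer2006Haruspicy2, Lemma 23] -/
theorem IsCanon.bottom_row (h : IsCanon W) (h2 : rowVerticalBonds (bonds W) 0 = 2) :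
    1 ≤ bottomWidth (bonds W) ∧ bottomWidth (bonds W) + 2 ≤ W.length ∧
    (∀ i ≤ bottomWidth (bonds W), vtx W i 0 = i ∧ vtx W i 1 = 0) ∧
    (vtx W (bottomWidth (bonds W) + 1) 0 = bottomWidth (bonds W) ∧
      vtx W (bottomWidth (bonds W) + 1) 1 = 1) ∧
    (vtx W (W.length - 1) 0 = 0 ∧ vtx W (W.length - 1) 1 = 1) ∧
    (∀ i, bottomWidth (bonds W) + 1 ≤ i → i ≤ W.length - 1 → 1 ≤ vtx W i 1) := by
  classical
  have hx1 := h.vtx_one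
  obtain ⟨⟨hN4, hc, hinj⟩, hr, -⟩ := h
  have hsap : IsSAP W := ⟨hN4, hc, hinj⟩
  have hy0 : ∀ i ≤ W.length, 0 ≤ vtx W i 1 := fun i hi => hr.vtx_one_nonneg' hc hi
  have hxN : vtx W W.length 0 = 0 := by rw [vtx_length, hc]; rfl
  -- the excursion above row `0`
  set S := (Finset.range W.length).filter fun i => IsCross 0 (vtx W i 1) (vtx W (i + 1) 1)
    with hS
  have hS2 : S.card = 2 := by rw [hS, ← rowVerticalBonds_bonds]; exact h2
  obtain ⟨p, q, hpq, hqN, hp0, hp1, hq1, hq0, hA, hB, hC⟩ :=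
    excursion_of_two_crossings (fun i => vtx W i 1) W.length 0 (fun i hi => dy_cases W hi)
      (by simp) S (fun i => by simp [hS]) hS2
  have hA0 : ∀ i ≤ p, vtx W i 1 = 0 := fun i hi => le_antisymm (hA i hi) (hy0 i (by omega))
  have hC0 : ∀ i, q < i → i ≤ W.length → vtx W i 1 = 0 := fun i h1 h2 =>
    le_antisymm (hC i h1 h2) (hy0 i h2)
  -- `p ≥ 1` since the first letter is `E`
  have hp1' : 1 ≤ p := by
    by_contra h0
    obtain rfl : p = 0 := by omega
    have := hx1.2
    simp only [Nat.zero_add] at hp1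
    omega
  -- `q = N - 1`: after `q` the walk is back on the axis, where it can go neither east nor west
  have hqN1 : q + 1 = W.length := by
    by_contra hne
    have hq2 : q + 2 ≤ W.length := by omega
    have hrun := hsap.run (le_refl W.length) (a := q + 1)
      (fun j hj hjN => by rw [hC0 (j + 1) (by omega) (by omega), hC0 j (by omega) (by omega)])
    obtain ⟨-, hxform, -⟩ := hrun W.length (by omega) le_rfl
    have hcast : ((W.length - (q + 1) : ℕ) : ℤ) = (W.length : ℤ) - (q + 1) := by
      push_cast [Nat.cast_sub (show q + 1 ≤ W.length by omega)]; ring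
    rw [hcast, hxN] at hxform
    rcases dx_of_horizontal W (show q + 1 < W.length by omega)
      (by rw [hC0 (q + 1 + 1) (by omega) (by omega), hC0 (q + 1) (by omega) (by omega)])
      with hd | hd
    · -- eastwards: `x (q+1) < 0` on the axis contradicts rootedness
      rw [hd] at hxform
      have := hr.vtx_zero_nonneg (show q + 1 < W.length by omega) (hC0 (q + 1) (by omega) (by omega))
      have hq1N : ((q + 1 : ℕ) : ℤ) + 1 ≤ W.length := by exact_mod_cast hq2
      nlinarith
    · -- westwards: the walk would revisit `(1, 0) = vtx W 1`
      obtain ⟨-, hxform', -⟩ := hrun (W.length - 1) (by omega) (by omega)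
      have hcast' : ((W.length - 1 - (q + 1) : ℕ) : ℤ) = (W.length : ℤ) - 1 - (q + 1) := by
        rw [Nat.cast_sub (by omega), Nat.cast_sub (by omega)]; push_cast; ring
      rw [hcast', hd] at hxform'
      have hxN1 : vtx W (W.length - 1) 0 = 1 := by nlinarith
      have heq : vtx W (W.length - 1) = vtx W 1 := by
        rw [site_eq_iff]
        exact ⟨by rw [hxN1, hx1.1], by rw [hC0 (W.length - 1) (by omega) (by omega), hx1.2]⟩
      have := hinj (show W.length - 1 ∈ Set.Iio W.length by simp; omega)
        (show 1 ∈ Set.Iio W.length by simp; omega) heq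
      omega
  -- along `[0, p]` the walk goes east: `vtx W i = (i, 0)`
  have hrun0 := hsap.run (show p ≤ W.length by omega) (a := 0)
    (fun j _ hjp => by rw [hA0 (j + 1) (by omega), hA0 j (by omega)])
  have hxi : ∀ i ≤ p, vtx W i 0 = i := by
    intro i hi
    obtain ⟨-, hx, -⟩ := hrun0 i (Nat.zero_le _) hi
    rw [hx, Nat.zero_add, hx1.1]
    simp
  -- the bottom row consists of the first `p` steps
  have hwp : bottomWidth (bonds W) = p := by
    rw [bottomWidth_bonds, hr.yMin_bonds]
    apply card_filter_range_eq (by omega)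
    intro i hi
    constructor
    · rintro ⟨h1, h2⟩
      by_contra hip
      rcases Nat.lt_or_ge p i with hpi | hpi
      · have := hB i hpi (by omega); omega
      · obtain rfl : i = p := by omega
        omega
    · intro hip; exact ⟨hA0 i hip.le, hA0 (i + 1) hip⟩
  rw [hwp]
  refine ⟨hp1', by omega, fun i hi => ⟨hxi i hi, hA0 i hi⟩, ⟨?_, hp1⟩, ⟨?_, ?_⟩, fun i h1 h2 =>
    hB i h1 (by omega)⟩
  · rw [dx_eq_zero_of_dy_ne W (by omega) (by rw [hp1, hp0]; omega), hxi p le_rfl]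
  · obtain rfl : W.length - 1 = q := by omega
    rw [← dx_eq_zero_of_dy_ne W hqN (by rw [hq0, hq1]; omega), hqN1, hxN]
  · obtain rfl : W.length - 1 = q := by omega
    exact hq1

end Bottom
/-! ### The orientation lemma: at the duplicated row the walk goes up on the right -/

section Orientation

variable {W : List (Fin 4)}

/-- Two vertices of a SAP word with equal coordinates have equal indices. [folklore] -/
theorem IsSAP.eq_of_vtx_eq (h : IsSAP W) {i j : ℕ} (hi : i < W.length) (hj : j < W.length)
    (h0 : vtx W i 0 = vtx W j 0) (h1 : vtx W i 1 = vtx W j 1) : i = j :=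
  h.2.2 (show i ∈ Set.Iio W.length from hi) (show j ∈ Set.Iio W.length from hj)
    (site_eq_iff.2 ⟨h0, h1⟩)

/-- The changes of ordinate inside a stretch `[a, b)`. [folklore] -/
def changes (W : List (Fin 4)) (a b : ℕ) : Finset ℕ :=
  (Finset.Ico a b).filter fun i => vtx W (i + 1) 1 ≠ vtx W i 1

/-- Membership in `changes`. [folklore] -/
theorem mem_changes {a b i : ℕ} : i ∈ changes W a b ↔ (a ≤ i ∧ i < b) ∧ vtx W (i + 1) 1 ≠ vtx W i 1 := by
  rw [changes, Finset.mem_filter, Finset.mem_Ico]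

/-- Parity of `changes` for a stretch inside a band of two heights. [folklore] -/
theorem card_changes_mod_two' {a b : ℕ} (hab : a ≤ b) (c : ℤ)
    (hval : ∀ i, a ≤ i → i ≤ b → vtx W i 1 = c ∨ vtx W i 1 = c + 1) :
    (changes W a b).card % 2 = if vtx W b 1 = vtx W a 1 then 0 else 1 :=
  card_changes_mod_two (fun i => vtx W i 1) c hab hval

/-- A stretch with a single change of ordinate at `s` is constant before and after `s`.
[folklore] -/
theorem runs_of_card_changes_eq_one {a b : ℕ} (h : (changes W a b).card = 1) :
    ∃ s, a ≤ s ∧ s < b ∧ vtx W (s + 1) 1 ≠ vtx W s 1 ∧ (∀ j, a ≤ j → j ≤ s → vtx W j 1 = vtx W a 1) ∧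
      (∀ j, s + 1 ≤ j → j ≤ b → vtx W j 1 = vtx W b 1) := by
  obtain ⟨s, hs⟩ := Finset.card_eq_one.1 h
  have hsC : s ∈ changes W a b := by rw [hs]; exact Finset.mem_singleton_self _
  rw [mem_changes] at hsC
  obtain ⟨⟨has, hsb⟩, hch⟩ := hsC
  have hnoch : ∀ i, a ≤ i → i < b → i ≠ s → vtx W (i + 1) 1 = vtx W i 1 := by
    intro i h1 h2 h3
    by_contra hne
    have : i ∈ changes W a b := mem_changes.2 ⟨⟨h1, h2⟩, hne⟩
    rw [hs, Finset.mem_singleton] at this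
    exact h3 this
  refine ⟨s, has, hsb, hch, fun j h1 h2 => ?_, fun j h1 h2 => ?_⟩
  · exact constant_of_no_change (fun i => vtx W i 1)
      (fun i hi1 hi2 => hnoch i hi1 (by omega) (by omega)) j h1 h2
  · have e := constant_of_no_change (fun i => vtx W i 1) (a := s + 1) (b := b)
      (fun i hi1 hi2 => hnoch i (by omega) hi2 (by omega))
    rw [e j h1 h2, e b (by omega) le_rfl]

/-- **The orientation lemma.** Let a SAP word run, inside the band of heights `{1, 2}`, from
`(R, 1)` (time `w + 1`, `R = w ≥ 1`) to height `2` at time `p`, and later from height `2` at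
time `q + 1` back to `(0, 1)` at time `N - 1`, the band's lower cell row carrying at most `4`
vertical bonds in all. Then the later stretch ends up to the LEFT of the earlier one:
`x (q+1) < x p`. (One of the two stretches has a single vertical bond, hence consists of two
straight runs forming a wall in one column, which the other stretch cannot pass.)
[cite: Rechnitzer2006Haruspicy2, Lemma 23 (Fig. 9)] -/
theorem IsSAP.lt_of_band (h : IsSAP W) {w p q : ℕ} (hw : 1 ≤ w) (hwp : w + 2 ≤ p)
    (hpq : p < q) (hqN : q + 2 ≤ W.length - 1)
    (hxw : vtx W (w + 1) 0 = w) (hyw : vtx W (w + 1) 1 = 1)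
    (hxN : vtx W (W.length - 1) 0 = 0) (hyN : vtx W (W.length - 1) 1 = 1)
    (hyp : vtx W p 1 = 2) (hyq : vtx W (q + 1) 1 = 2)
    (hband₁ : ∀ i, w + 1 ≤ i → i ≤ p → 1 ≤ vtx W i 1 ∧ vtx W i 1 ≤ 2)
    (hband₂ : ∀ i, q + 1 ≤ i → i ≤ W.length - 1 → 1 ≤ vtx W i 1 ∧ vtx W i 1 ≤ 2)
    (h4 : rowVerticalBonds (bonds W) 1 ≤ 4) :
    vtx W (q + 1) 0 < vtx W p 0 := by
  classical
  -- the changes of height inside the two stretches: at most `4` in all, each an odd number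
  have hsum : (changes W (w + 1) p).card + (changes W (q + 1) (W.length - 1)).card ≤ 4 := by
    rw [← Finset.card_union_of_disjoint]
    · refine le_trans (Finset.card_le_card ?_)
        (le_trans (le_of_eq (rowVerticalBonds_bonds W 1).symm) h4)
      intro i hi
      rw [Finset.mem_union, mem_changes, mem_changes] at hi
      simp only [Finset.mem_filter, Finset.mem_range, IsCross]
      rcases hi with hi | hi
      · have h1 := hband₁ i hi.1.1 (by omega)
        have h2 := hband₁ (i + 1) (by omega) (by omega)
        exact ⟨by omega, by omega⟩
      · have h1 := hband₂ i hi.1.1 (by omega)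
        have h2 := hband₂ (i + 1) (by omega) (by omega)
        exact ⟨by omega, by omega⟩
    · rw [Finset.disjoint_left]
      intro i h1 h2
      rw [mem_changes] at h1 h2
      omega
  have hodd₁ : (changes W (w + 1) p).card % 2 = 1 := by
    rw [card_changes_mod_two' (show w + 1 ≤ p by omega) 1
      (fun i h1 h2 => by have := hband₁ i h1 h2; omega), hyp, hyw]
    norm_num
  have hodd₂ : (changes W (q + 1) (W.length - 1)).card % 2 = 1 := by
    rw [card_changes_mod_two' (show q + 1 ≤ W.length - 1 by omega) 1
      (fun i h1 h2 => by have := hband₂ i h1 h2; omega), hyq, hyN]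
    norm_num
  have hcases : (changes W (w + 1) p).card = 1 ∨ (changes W (q + 1) (W.length - 1)).card = 1 := by
    omega
  rcases hcases with hc | hc
  · -- the first stretch is two straight runs with a wall in column `c = x s`
    obtain ⟨s, hws, hsp, -, hrun₁, hrun₂⟩ := runs_of_card_changes_eq_one hc
    rw [hyw] at hrun₁
    rw [hyp] at hrun₂
    have hys : vtx W s 1 = 1 := hrun₁ s hws le_rfl
    have hys1 : vtx W (s + 1) 1 = 2 := hrun₂ (s + 1) le_rfl (by omega)
    have hxs1 : vtx W (s + 1) 0 = vtx W s 0 := dx_eq_zero_of_dy_ne W (by omega) (by omega)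
    -- the second stretch avoids the wall column
    have havoid : ∀ j, q + 1 ≤ j → j ≤ W.length - 1 → vtx W j 0 ≠ vtx W s 0 := by
      intro j h1 h2 hx
      have hb := hband₂ j h1 h2
      rcases (show vtx W j 1 = 1 ∨ vtx W j 1 = 2 by omega) with hj | hj
      · have := h.eq_of_vtx_eq (show j < W.length by omega) (show s < W.length by omega) hx (by rw [hj, hys])
        omega
      · have := h.eq_of_vtx_eq (show j < W.length by omega) (show s + 1 < W.length by omega) (by rw [hx, hxs1])
          (by rw [hj, hys1])
        omega
    -- the wall is to the right of the root column
    have hc0 : 0 < vtx W s 0 := by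
      by_contra hle
      have hne := havoid (W.length - 1) (by omega) le_rfl
      rw [hxN] at hne
      obtain ⟨j, h1, h2, h3⟩ := cover W (show w + 1 ≤ s from hws) (by omega) (z := 0)
        (by rw [hxw]; omega)
      have := h.eq_of_vtx_eq (show j < W.length by omega) (show W.length - 1 < W.length by omega)
        (by rw [h3, hxN]) (by rw [hrun₁ j h1 h2, hyN])
      omega
    -- hence the whole second stretch is to the left of the wall
    have hleft : ∀ j, q + 1 ≤ j → j ≤ W.length - 1 → vtx W j 0 < vtx W s 0 := by
      intro j h1 h2
      by_contra hge
      have hgt : vtx W s 0 < vtx W j 0 := lt_of_le_of_ne (not_lt.1 hge) (havoid j h1 h2).symm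
      obtain ⟨j', h1', h2', h3'⟩ := cover W h2 (by omega) (z := vtx W s 0) (by rw [hxN]; omega)
      exact havoid j' (by omega) h2' h3'
    have ha := hleft (q + 1) le_rfl (by omega)
    -- and `a < b`, for otherwise the upper run of the first stretch would pass through `(a, 2)`
    by_contra hba
    obtain ⟨j, h1, h2, h3⟩ := cover W (show s + 1 ≤ p by omega) (by omega)
      (z := vtx W (q + 1) 0) (by rw [hxs1]; omega)
    have := h.eq_of_vtx_eq (show j < W.length by omega) (show q + 1 < W.length by omega) h3
      (by rw [hrun₂ j h1 h2, hyq])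
    omega
  · -- the second stretch is two straight runs with a wall in column `d = x u`
    obtain ⟨u, hqu, huN, -, hrun₁, hrun₂⟩ := runs_of_card_changes_eq_one hc
    rw [hyq] at hrun₁
    rw [hyN] at hrun₂
    have hyu : vtx W u 1 = 2 := hrun₁ u hqu le_rfl
    have hyu1 : vtx W (u + 1) 1 = 1 := hrun₂ (u + 1) le_rfl (by omega)
    have hxu1 : vtx W (u + 1) 0 = vtx W u 0 := dx_eq_zero_of_dy_ne W (by omega) (by omega)
    -- the first stretch avoids the wall column
    have havoid : ∀ j, w + 1 ≤ j → j ≤ p → vtx W j 0 ≠ vtx W u 0 := by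
      intro j h1 h2 hx
      have hb := hband₁ j h1 h2
      rcases (show vtx W j 1 = 1 ∨ vtx W j 1 = 2 by omega) with hj | hj
      · have := h.eq_of_vtx_eq (show j < W.length by omega) (show u + 1 < W.length by omega) (by rw [hx, hxu1])
          (by rw [hj, hyu1])
        omega
      · have := h.eq_of_vtx_eq (show j < W.length by omega) (show u < W.length by omega) hx (by rw [hj, hyu])
        omega
    -- the wall is to the left of column `R = w`
    have hdw : vtx W u 0 < w := by
      by_contra hle
      have hne := havoid (w + 1) le_rfl (by omega)
      rw [hxw] at hne
      obtain ⟨j, h1, h2, h3⟩ := cover W (show u + 1 ≤ W.length - 1 by omega) (by omega)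
        (z := (w : ℤ)) (by rw [hxu1, hxN]; omega)
      have := h.eq_of_vtx_eq (show j < W.length by omega) (show w + 1 < W.length by omega)
        (by rw [h3, hxw]) (by rw [hrun₂ j h1 h2, hyw])
      omega
    -- hence the whole first stretch is to the right of the wall
    have hright : ∀ j, w + 1 ≤ j → j ≤ p → vtx W u 0 < vtx W j 0 := by
      intro j h1 h2
      by_contra hge
      have hlt : vtx W j 0 < vtx W u 0 := lt_of_le_of_ne (not_lt.1 hge) (havoid j h1 h2)
      obtain ⟨j', h1', h2', h3'⟩ := cover W h1 (by omega) (z := vtx W u 0) (by rw [hxw]; omega)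
      exact havoid j' h1' (by omega) h3'
    have hb := hright p (by omega) le_rfl
    -- and `a < b`, for otherwise the upper run of the second stretch would pass through `(b, 2)`
    by_contra hba
    obtain ⟨j, h1, h2, h3⟩ := cover W (show q + 1 ≤ u from hqu) (by omega) (z := vtx W p 0)
      (by omega)
    have := h.eq_of_vtx_eq (show j < W.length by omega) (show p < W.length by omega) h3
      (by rw [hrun₁ j h1 h2, hyp])
    omega

end Orientation
/-! ### The band decomposition of a canonical 2-4-2 word -/

section Band

variable {W : List (Fin 4)}

/-- **The band decomposition** `W = E^w N α₁ N β S α₂ S` of a canonical word whose three lowest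
cell rows carry `2, ≤ 4, 2` vertical bonds: the bottom row `E^w` (times `0, …, w`), the stretch
`α₁` in the band of heights `{1, 2}` up to time `p`, the up-step at `p` in column `b = x p`, the
excursion `β` at heights `≥ 3` (times `p + 1, …, q`), the down-step at `q` in column
`a = x (q + 1)`, the stretch `α₂` in the band back to `(0, 1)`, and the final `S`; moreover
`a < b` (`IsSAP.lt_of_band`). [cite: Rechnitzer2006Haruspicy2, Lemma 23 (Figs. 9–10)] -/
structure IsBand (W : List (Fin 4)) (w p q : ℕ) : Prop where
  /-- the bottom row is not empty -/
  one_le : 1 ≤ w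
  /-- `α₁` takes at least one step -/
  le_p : w + 2 ≤ p
  /-- `β` is traversed from `p + 1` to `q` -/
  p_lt_q : p < q
  /-- `α₂` takes at least one step -/
  q_le : q + 2 ≤ W.length - 1
  /-- the bottom row: `vtx W i = (i, 0)` for `i ≤ w` -/
  bottom : ∀ i ≤ w, vtx W i 0 = i ∧ vtx W i 1 = 0
  /-- `α₁` starts at `(w, 1)` -/
  x_w1 : vtx W (w + 1) 0 = w
  /-- `α₁` starts at `(w, 1)` -/
  y_w1 : vtx W (w + 1) 1 = 1
  /-- `α₂` ends at `(0, 1)` -/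
  x_N1 : vtx W (W.length - 1) 0 = 0
  /-- `α₂` ends at `(0, 1)` -/
  y_N1 : vtx W (W.length - 1) 1 = 1
  /-- the up-step at `p` … -/
  y_p : vtx W p 1 = 2
  /-- … reaches height `3` … -/
  y_p1 : vtx W (p + 1) 1 = 3
  /-- … in column `b = x p` -/
  x_p1 : vtx W (p + 1) 0 = vtx W p 0
  /-- the down-step at `q` … -/
  y_q : vtx W q 1 = 3
  /-- … reaches height `2` … -/
  y_q1 : vtx W (q + 1) 1 = 2
  /-- … in column `a = x (q + 1)` -/
  x_q1 : vtx W (q + 1) 0 = vtx W q 0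
  /-- `α₁` lives in the band -/
  band₁ : ∀ i, w + 1 ≤ i → i ≤ p → 1 ≤ vtx W i 1 ∧ vtx W i 1 ≤ 2
  /-- `β` lives above the band -/
  top : ∀ i, p < i → i ≤ q → 3 ≤ vtx W i 1
  /-- `α₂` lives in the band -/
  band₂ : ∀ i, q + 1 ≤ i → i ≤ W.length - 1 → 1 ≤ vtx W i 1 ∧ vtx W i 1 ≤ 2
  /-- the orientation: `a < b` -/
  lt : vtx W (q + 1) 0 < vtx W p 0

/-- **Existence of the band decomposition** for a canonical word whose three lowest cell rows
carry `2, ≤ 4, 2` vertical bonds (a canonical 2-4-2 word with at least three rows, or a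
building block). [cite: Rechnitzer2006Haruspicy2, Lemma 23] -/
theorem IsCanon.exists_isBand (h : IsCanon W) (h0 : rowVerticalBonds (bonds W) 0 = 2)
    (h1 : rowVerticalBonds (bonds W) 1 ≤ 4) (h2 : rowVerticalBonds (bonds W) 2 = 2) :
    ∃ p q, IsBand W (bottomWidth (bonds W)) p q := by
  classical
  obtain ⟨hw1, hwN, hbot, ⟨hxw, hyw⟩, ⟨hxN, hyN⟩, hge1⟩ := h.bottom_row h0
  set w := bottomWidth (bonds W) with hw
  obtain ⟨⟨hN4, hc, hinj⟩, hr, -⟩ := h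
  have hsap : IsSAP W := ⟨hN4, hc, hinj⟩
  -- the excursion above row `2`
  set S := (Finset.range W.length).filter fun i => IsCross 2 (vtx W i 1) (vtx W (i + 1) 1)
    with hS
  have hS2 : S.card = 2 := by rw [hS, ← rowVerticalBonds_bonds]; exact h2
  obtain ⟨p, q, hpq, hqN, hp2, hp3, hq3, hq2, hA, hB, hC⟩ :=
    excursion_of_two_crossings (fun i => vtx W i 1) W.length 2 (fun i hi => dy_cases W hi)
      (by simp) S (fun i => by simp [hS]) hS2
  have hwp : w + 2 ≤ p := by
    by_contra hlt
    rcases Nat.lt_or_ge p (w + 1) with hpw | hpw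
    · have := (hbot p (by omega)).2; omega
    · obtain rfl : p = w + 1 := by omega
      omega
  have hyNN : vtx W W.length 1 = 0 := by rw [vtx_length, hc]; rfl
  have hq2' : q + 2 ≤ W.length - 1 := by
    by_contra hlt
    rcases (show q + 1 = W.length - 1 ∨ q + 1 = W.length by omega) with he | he
    · rw [he] at hq2; omega
    · rw [he] at hq2; omega
  have hband₁ : ∀ i, w + 1 ≤ i → i ≤ p → 1 ≤ vtx W i 1 ∧ vtx W i 1 ≤ 2 := fun i hi1 hi2 =>
    ⟨hge1 i hi1 (by omega), hA i hi2⟩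
  have hband₂ : ∀ i, q + 1 ≤ i → i ≤ W.length - 1 → 1 ≤ vtx W i 1 ∧ vtx W i 1 ≤ 2 :=
    fun i hi1 hi2 => ⟨hge1 i (by omega) hi2, hC i (by omega) (by omega)⟩
  refine ⟨p, q, ⟨hw1, hwp, hpq, hq2', hbot, hxw, hyw, hxN, hyN, hp2, hp3,
    dx_eq_zero_of_dy_ne W (by omega) (by omega), hq3, hq2,
    dx_eq_zero_of_dy_ne W hqN (by omega), hband₁, hB, hband₂, ?_⟩⟩
  exact hsap.lt_of_band hw1 hwp hpq hq2' hxw hyw hxN hyN hp2 hq2 hband₁ hband₂ h1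

namespace IsBand

variable {w p q : ℕ}

/-- The columns `a < b` of the duplicated row, as a natural number `t = b - a ≥ 1`. [folklore] -/
theorem one_le_toNat (hb : IsBand W w p q) : 1 ≤ (vtx W p 0 - vtx W (q + 1) 0).toNat := by
  have := hb.lt; omega

/-- `b = a + t`. [folklore] -/
theorem x_p_eq (hb : IsBand W w p q) :
    vtx W p 0 = vtx W (q + 1) 0 + ((vtx W p 0 - vtx W (q + 1) 0).toNat : ℕ) := by
  have := hb.lt; omega

/-- **The top run of a building block.** If moreover all heights are `≤ 3` (a building block:
`yMax = 3`), the excursion `β` is the straight run `W^t` at height `3` from `(b, 3)` to `(a, 3)`,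
`t = b - a = q - p - 1`. [cite: Rechnitzer2006Haruspicy2, Lemma 23] -/
theorem top_run (hb : IsBand W w p q) (hsap : IsSAP W) (h3 : ∀ i < W.length, vtx W i 1 ≤ 3) :
    q = p + 1 + (vtx W p 0 - vtx W (q + 1) 0).toNat ∧
    (∀ j, p + 1 ≤ j → j ≤ q → vtx W j 1 = 3 ∧ vtx W j 0 = vtx W p 0 - ((j - (p + 1) : ℕ) : ℤ)) ∧
    (∀ j, (h1 : p + 1 ≤ j) → (h2 : j < q) → W[j]'(by have := hb.q_le; omega) = 1) := by
  have hq := hb.q_le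
  have hy3 : ∀ j, p + 1 ≤ j → j ≤ q → vtx W j 1 = 3 := fun j h1 h2 =>
    le_antisymm (h3 j (by omega)) (hb.top j (by omega) h2)
  have hrun := hsap.run (show q ≤ W.length by omega) (a := p + 1)
    (fun j h1 h2 => by rw [hy3 (j + 1) (by omega) (by omega), hy3 j h1 (by omega)])
  -- the run is not empty and goes west
  have hpq : p + 1 < q := by
    have hlt := hb.lt
    have e1 := hb.x_q1
    have e2 := hb.x_p1
    by_contra hle
    have : q = p + 1 := by have := hb.p_lt_q; omega
    rw [this] at hlt e1
    rw [e1, e2] at hlt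
    exact lt_irrefl _ hlt
  have hd : vtx W (p + 1 + 1) 0 - vtx W (p + 1) 0 = -1 := by
    rcases dx_of_horizontal W (show p + 1 < W.length by omega)
      (by rw [hy3 (p + 1 + 1) (by omega) (by omega), hy3 (p + 1) le_rfl (by omega)]) with hd | hd
    · -- eastwards the run would end to the right of `b`, but it ends at `a < b`
      exfalso
      obtain ⟨-, hx, -⟩ := hrun q (by omega) le_rfl
      rw [hd, hb.x_p1, mul_one] at hx
      have h1 := hb.lt
      rw [hb.x_q1] at h1
      have : (0 : ℤ) ≤ ((q - (p + 1) : ℕ) : ℤ) := Nat.cast_nonneg _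
      omega
    · exact hd
  have hxj : ∀ j, p + 1 ≤ j → j ≤ q → vtx W j 0 = vtx W p 0 - ((j - (p + 1) : ℕ) : ℤ) := by
    intro j h1 h2
    obtain ⟨-, hx, -⟩ := hrun j h1 h2
    rw [hx, hd, hb.x_p1]
    ring
  have hqeq : q = p + 1 + (vtx W p 0 - vtx W (q + 1) 0).toNat := by
    have hx := hxj q (by omega) le_rfl
    rw [← hb.x_q1] at hx
    have hcast : ((q - (p + 1) : ℕ) : ℤ) = (q : ℤ) - (p + 1) := by
      rw [Nat.cast_sub (by omega)]; push_cast; ring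
    rw [hcast] at hx
    omega
  refine ⟨hqeq, fun j h1 h2 => ⟨hy3 j h1 h2, hxj j h1 h2⟩, fun j h1 h2 => ?_⟩
  apply eq_one_of_dx W (by omega)
  obtain ⟨-, -, hstep⟩ := hrun j h1 h2.le
  have := hstep h2
  rw [hd] at this
  omega

end IsBand

end Band
end Haruspicy

end Literature.Barriers.CriticalPhenomena
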